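import Literature.AlgebraicGeometry.AbelianSchemes.PolarizedAbelianSchemeWithLevelBaseChangeUnique
import Literature.AlgebraicGeometry.AbelianSchemes.PolarizationLevelBaseQuotientDescent
import Literature.AlgebraicGeometry.AbelianSchemes.AbelianSchemeOverZariskiGluingHom
import Literature.AlgebraicGeometry.AbelianSchemes.PolarizedLevelChange
import HarnessLib

/-!
# Two refinements of one triple along the same base map live on one abelian scheme
# ([MumfordFogartyKirwan1994] Ch. 7 §2 Def. 7.2 «up to isomorphism» + Ch. 7 §3 p. 139: two level-`nm` structures over one level-`n` structure)

Layer `Literature/AlgebraicGeometry/AbelianSchemes`, namespace `Literature.AlgebraicGeometry.AbelianSchemes.PolarizedAbelianSchemeWithLevel`.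
THEOREMS ONLY (no definition, no named fact, no instance, no notation, no `sorry`).  Cell `hodgecm-mathlib` (D-0151), F-DAG
F-10 (b) «classify for `M/Γ`», step (b2), byte (α) (author B-p02 (g13); census `B-provers/B-p06/g11/F10b-CENSUS-SKELETON.B-p06g11.md`
§road 2: «transport `pr₂^*η′` to the abelian scheme of `pr₁^*P′` … two level-`NK` structures on ONE abelian scheme refining the
same level-`N` structure»).  Count-neutral capital; HC_CM is proved only modulo the 7 printed citations until rung 0 closes —
nothing here is about HC.

The situation.  `Y` is a polarised abelian scheme with symplectic-liftable level-`N` structure over `S` ([MFK94] Def. 7.2's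
object), `f : T → S`, and `P₁`, `P₂` are two triples of level `M = N·K` over `T` whose level-`N` REDUCTIONS (★
`PolarizedAbelianSchemeWithLevel.changeLevel`) are both pull-backs of `Y` along `f` (★ `IsBaseChangeVia`, [MFK94] Def. 7.2:
`𝒜(f)` is well-defined on isomorphism classes).  By ★ `IsBaseChangeVia.exists_isBaseChangeVia_id_of_isBaseChangeVia` the two
reductions are isomorphic AS TRIPLES over `T` (`H : X₂ ≅ X₁`, `Ĥ : X̂₂ ≅ X̂₁` along `𝟙 T`); moving the level-`M` structure of
`P₂` along `H` (★ `LevelStructure.exists_comp_of_iso`; `H` is a homomorphism, ★ `isMonHom_of_isBaseChangeVia_id`) gives: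

* **`exists_level_isBaseChangeVia_id_of_changeLevel`** — a level-`M` structure `χ` on `P₁`'s abelian scheme, symplectic-
  liftable for `P₁`'s polarisation (★ `LevelStructure.isSymplecticLiftable_of_isBaseChangeVia` along `𝟙 T`), such that `P₂`
  is the pull-back of `(P₁ with level χ)` along `𝟙 T` via `(H, Ĥ)` (so the two have THE SAME CLASSIFYING MORPHISM to any fine
  moduli carrier, ★ `SiegelFineModuliScheme.classifyingMap_comp`), and `χ.changeLevel N K = P₁.level.changeLevel N K` — two
  symplectic-liftable level-`M` structures `P₁.level`, `χ` on ONE abelian scheme refining the same level-`N` structure, the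
  input of ★ `LevelStructure.exists_openCover_comp_left_eq_twist_of_changeLevel_eq` ((b1‴)).

The consumer (b2) takes `T := W ×_S W` for a refinement cover `W → S` and `Pᵢ := P′ ×_W prᵢ`.

## References
* [MumfordFogartyKirwan1994] D. Mumford, J. Fogarty, F. Kirwan, *Geometric Invariant Theory*, 3rd ed. (1994), Ch. 7 §2
  Definition 7.2 and Definition 7.3 (p. 129); Ch. 7 §3 (p. 139).
* [Lan2013PELCompactifications] K.-W. Lan, *Arithmetic compactifications of PEL-type Shimura varieties* (2013), §1.3.6
  Lemma 1.3.6.6 and Cor. 1.3.6.7 (pp. 81–82).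
-/

noncomputable section

universe u

open CategoryTheory CategoryTheory.Limits AlgebraicGeometry

namespace Literature.AlgebraicGeometry.AbelianSchemes

namespace PolarizedAbelianSchemeWithLevel

open AbelianSchemeOver
open scoped MonObj

variable {g N M K : ℕ} {δ : Fin g → ℕ} {S T : Scheme.{u}} {Y : PolarizedAbelianSchemeWithLevel g N δ S} {f : T ⟶ S}
  {P₁ P₂ : PolarizedAbelianSchemeWithLevel g M δ T}
  {G₁ : P₁.A.X.left ⟶ Y.A.X.left} {Ĝ₁ : P₁.D.hat.X.left ⟶ Y.D.hat.X.left}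
  {G₂ : P₂.A.X.left ⟶ Y.A.X.left} {Ĝ₂ : P₂.D.hat.X.left ⟶ Y.D.hat.X.left}

/-- **TWO REFINEMENTS OF ONE TRIPLE ALONG THE SAME BASE MAP LIVE ON ONE ABELIAN SCHEME.**  If the level-`N` reductions of
the level-`M` triples `P₁`, `P₂` over `T` (`M = N·K`) are both pull-backs of `Y` along `f : T → S`, then there are a
level-`M` structure `χ` on `P₁`'s abelian scheme, symplectic-liftable for `P₁`'s polarisation, and isomorphisms `H : X₂ → X₁`,
`Ĥ : X̂₂ → X̂₁` exhibiting `P₂` as the pull-back of `(P₁ with level χ)` along `𝟙 T`, with `χ.changeLevel N K =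
P₁.level.changeLevel N K`.  Construction: `(H, Ĥ)` = the isomorphism of the two reductions (★
`IsBaseChangeVia.exists_isBaseChangeVia_id_of_isBaseChangeVia`), `χᵢ := (P₂.level)ᵢ ≫ H` (★ `LevelStructure.exists_comp_of_iso`,
`H` a homomorphism by ★ `isMonHom_of_isBaseChangeVia_id`), liftability by ★ `LevelStructure.isSymplecticLiftable_of_isBaseChangeVia`
along `𝟙 T` (all its clauses are clauses of the isomorphism of triples), `changeLevel` by `(σ ≫ H)^K = σ^K ≫ H`.
[cite: MumfordFogartyKirwan1994, Ch. 7 §2 Definition 7.2 (p. 129) and §3 (p. 139)]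
[cite: Lan2013PELCompactifications, §1.3.6 Lemma 1.3.6.6 and Cor. 1.3.6.7 (pp. 81–82)] -/
theorem exists_level_isBaseChangeVia_id_of_changeLevel (hd : M = N * K) (hM : M ≠ 0)
    (h₁ : (P₁.changeLevel N K hd hM).IsBaseChangeVia Y f G₁ Ĝ₁)
    (h₂ : (P₂.changeLevel N K hd hM).IsBaseChangeVia Y f G₂ Ĝ₂) :
    ∃ (χ : P₁.A.LevelStructure g M) (hχ : χ.IsSymplecticLiftable P₁.pol δ)
      (H : P₂.A.X.left ⟶ P₁.A.X.left) (Ĥ : P₂.D.hat.X.left ⟶ P₁.D.hat.X.left),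
      IsIso H ∧ IsIso Ĥ ∧ H ≫ G₁ = G₂ ∧ Ĥ ≫ Ĝ₁ = Ĝ₂ ∧
      P₂.IsBaseChangeVia ({ P₁ with level := χ, symplectic := hχ } : PolarizedAbelianSchemeWithLevel g M δ T)
        (𝟙 T) H Ĥ ∧
      χ.changeLevel N K hd hM = P₁.level.changeLevel N K hd hM := by
  -- the isomorphism of the two level-`N` reductions, as triples over `T`
  obtain ⟨H, Ĥ, hHiso, hĤiso, hHG, hĤG, hQ⟩ := h₁.exists_isBaseChangeVia_id_of_isBaseChangeVia h₂
  obtain ⟨hlev, hhat, ⟨wG, wĜ, ⟨eP⟩⟩, hlam⟩ := hQ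
  haveI := hHiso
  -- `hlev.1 : P₂.A.IsBaseChangeVia P₁.A (𝟙 T) H`; the `Over`-isomorphism `e : X₂ ≅ X₁` underlying `H`
  obtain ⟨w, -, -, -⟩ := hlev.1
  obtain ⟨e, he⟩ : ∃ e : P₂.A.X ≅ P₁.A.X, e.hom.left = H :=
    ⟨Over.isoMk (@asIso _ _ _ _ H hHiso) (w.trans (Category.comp_id _)), Over.isoMk_hom_left _ _⟩
  haveI : IsMonHom e.hom := isMonHom_of_isBaseChangeVia_id e.hom (he ▸ hlev.1)
  -- move `P₂`'s level-`M` structure along `e`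
  obtain ⟨χ, hχσ⟩ := LevelStructure.exists_comp_of_iso e P₂.level
  have hσ : ∀ i, (P₂.level.σ i).left ≫ H = 𝟙 T ≫ (χ.σ i).left := fun i => by
    rw [hχσ i, Over.comp_left, he]
    exact (Category.id_comp _).symm
  -- liftability moves along the isomorphism of triples (all clauses of `isSymplecticLiftable_of_isBaseChangeVia` along `𝟙 T`)
  have hχ : χ.IsSymplecticLiftable P₁.pol δ :=
    LevelStructure.isSymplecticLiftable_of_isBaseChangeVia (hAB := hlev.1) (D := P₂.D) (DB := P₁.D) (hABh := hhat)
      P₂.level χ hσ P₂.pol P₁.pol hlam ⟨eP⟩ δ P₂.symplectic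
  refine ⟨χ, hχ, H, Ĥ, hHiso, hĤiso, hHG, hĤG, ⟨⟨hlev.1, hσ⟩, hhat, ⟨wG, wĜ, ⟨eP⟩⟩, hlam⟩, ?_⟩
  -- `χ.changeLevel N K = P₁.level.changeLevel N K`: `(σ₂ᵢ ≫ H)^K = σ₂ᵢ^K ≫ H = σ₁ᵢ^K` by the level clause of the reductions
  apply LevelStructure.ext_σ
  funext i
  apply Over.OverMorphism.ext
  have h2 := hlev.2 i
  rw [Category.id_comp] at h2
  rw [LevelStructure.changeLevel_σ, LevelStructure.changeLevel_σ, hχσ i, ← MonObj.pow_comp, Over.comp_left, he]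
  exact h2

end PolarizedAbelianSchemeWithLevel

end Literature.AlgebraicGeometry.AbelianSchemes

end
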